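import Summits.RiemannHypothesis.RiemannHypothesis.Theorems.WeilLegendreBlocks136Base
import Literature.NumberTheory.LFunctions.WeilBlockRows
import Literature.NumberTheory.LFunctions.WeilBlockRowsDCFast
import HarnessLib

/-!
# Odd Legendre blocks at `nb = 136`: rows 8–11 of the check `D C = I`

`WeilCert.checkDCRow 1` for the block base `weilBlocks136Base`, row by row via the linear-traversal check `WeilCert.checkDCRowF` (`decide +kernel`) and `WeilCert.checkDCRow_of_F`. Pure proof file; nothing is asserted.
-/

noncomputable section

set_option linter.dupNamespace false

namespace Summit.RiemannHypothesis.RiemannHypothesis.Theorems.EvenWinsBeyondArch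

open Literature.NumberTheory.LFunctions

set_option maxHeartbeats 0 in
/-- Fast kernel check of row 8 of `D C = I` (odd blocks, `nb = 136`; linear traversals). [folklore] -/
theorem checkDCRowF1_8_weilBlocks136 : weilBlocks136Base.checkDCRowF 1 8 = true := by
  decide +kernel

/-- Row 8 of `D C = I` (odd blocks, `nb = 136`), from the fast check. [folklore] -/
theorem checkDCRow1_8_weilBlocks136 : weilBlocks136Base.checkDCRow 1 8 = true :=
  WeilCert.checkDCRow_of_F checkDCRowF1_8_weilBlocks136

set_option maxHeartbeats 0 in
/-- Fast kernel check of row 9 of `D C = I` (odd blocks, `nb = 136`; linear traversals). [folklore] -/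
theorem checkDCRowF1_9_weilBlocks136 : weilBlocks136Base.checkDCRowF 1 9 = true := by
  decide +kernel

/-- Row 9 of `D C = I` (odd blocks, `nb = 136`), from the fast check. [folklore] -/
theorem checkDCRow1_9_weilBlocks136 : weilBlocks136Base.checkDCRow 1 9 = true :=
  WeilCert.checkDCRow_of_F checkDCRowF1_9_weilBlocks136

set_option maxHeartbeats 0 in
/-- Fast kernel check of row 10 of `D C = I` (odd blocks, `nb = 136`; linear traversals). [folklore] -/
theorem checkDCRowF1_10_weilBlocks136 : weilBlocks136Base.checkDCRowF 1 10 = true := by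
  decide +kernel

/-- Row 10 of `D C = I` (odd blocks, `nb = 136`), from the fast check. [folklore] -/
theorem checkDCRow1_10_weilBlocks136 : weilBlocks136Base.checkDCRow 1 10 = true :=
  WeilCert.checkDCRow_of_F checkDCRowF1_10_weilBlocks136

set_option maxHeartbeats 0 in
/-- Fast kernel check of row 11 of `D C = I` (odd blocks, `nb = 136`; linear traversals). [folklore] -/
theorem checkDCRowF1_11_weilBlocks136 : weilBlocks136Base.checkDCRowF 1 11 = true := by
  decide +kernel

/-- Row 11 of `D C = I` (odd blocks, `nb = 136`), from the fast check. [folklore] -/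
theorem checkDCRow1_11_weilBlocks136 : weilBlocks136Base.checkDCRow 1 11 = true :=
  WeilCert.checkDCRow_of_F checkDCRowF1_11_weilBlocks136


end Summit.RiemannHypothesis.RiemannHypothesis.Theorems.EvenWinsBeyondArch
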